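import Literature.NumberTheory.EllipticCurves.ThetaDatumWeierstrass
import Literature.NumberTheory.GaloisRepresentations.ContinuousH2
import Literature.NumberTheory.EllipticCurves.KummerSelmerStructure
import Literature.NumberTheory.GaloisRepresentations.AbsGaloisGroupCompact
import HarnessLib

/-!
# The Poonen–Rains quadratic cocycle `H¹(L, E[2]) → H²(L, μ₂)` at level `2` (continuous cochains)

For an elliptic curve `E/K` (Weierstrass model `W`, `2 ≠ 0` in `K`) and a `K`-field `L` (typically a
completion `K_v`, or any extension; `Γ_L` acts on `E[2](K̄)` and `μ₂(K̄)` through the tree's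
restriction `absGaloisRestrict K L : Γ_L → Γ_K`), this file turns the `μ₂`-valued Heisenberg (theta)
datum `heisenbergMu W h2` (`ThetaDatumWeierstrass.lean`) into cohomology:

* `localDatum W h2 L` — the datum pulled back to `Γ_L`;
* `prCocycle W h2 L ξ : contTwoCocycles (μ₂|_{Γ_L})` — for a continuous crossed homomorphism
  `ξ : Γ_L → E[2]` (an element of `contOneCocycles` of the restricted module `E[2]|_{Γ_L}`), the
  continuous inhomogeneous `2`-cocycle `(σ, τ) ↦ χ_σ(ξ_τ) · m(ξ_σ, σ ξ_τ) ∈ μ₂` (continuity: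
  `continuous_prFun`; cocycle identity: `HeisenbergDatum.conn_cocycle`);
* `prClass W h2 L : H¹(Γ_L, E[2]) → H²(Γ_L, μ₂)` — the induced map on classes (`prClass_oneCocycleClass`;
  well defined by `HeisenbergDatum.conn_coboundary`), i.e. the POONEN–RAINS / ZARHIN QUADRATIC MAP
  `q_L` (connecting map of the Heisenberg group `1 → μ₂ → 𝓗 → E[2] → 0`, Poonen–Rains 2012 Cor. 4.6),
  here CONSTRUCTED from explicit cochains; `prClass_zero`.

The polar form (cup product for the Weil pairing, `conn_add`), the isotropy of Kummer classes and the
reciprocity law are the objects of the sequels.  References: B. Poonen, E. Rains, *Random maximal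
isotropic subspaces and Selmer groups*, JAMS 25 (2012) §4.1, Cor. 4.6 [PoonenRains2012]; J.-P. Serre,
*Galois Cohomology* I §5.7 (connecting map `H¹ → H²` of a central extension) [SerreGaloisCohomology1997].
No named fact is introduced.
-/

set_option autoImplicit false

noncomputable section

open scoped Classical

namespace Literature.NumberTheory.EllipticCurves

namespace ThetaLevelTwo

open Literature.Algebra.Homology
open Literature.NumberTheory.GaloisRepresentations Literature.NumberTheory.GaloisRepresentations.DiscreteGaloisModule
open Literature.NumberTheory.EllipticCurves.DokchitserDokchitser2012 (frame)
open WeierstrassCurve Field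

universe u

variable {K : Type u} [Field K]

section MuRho

variable (L : Type u) [Field L] [Algebra K L]

/-- The action in the restricted topological module `μ₂|_{Γ_L}`. [cite: SerreGaloisCohomology1997, I §2.4 (compatible pairs)] -/
theorem toTopRep_mu_ρ_apply (σ : absoluteGaloisGroup L) (z : MuCarrier K 2) :
    (DiscreteGaloisModule.toTopRep (GaloisRep.restrictField L (mu K 2))).ρ σ z
      = mu K 2 (absGaloisRestrict K L σ) z := rfl

end MuRho

variable (W : WeierstrassCurve K) [W.IsElliptic] (h2 : (2 : K) ≠ 0)

/-! ### Continuity of the correction terms `σ ↦ χ_σ(P)` on `Γ_K` -/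

/-- The correction term of the `K̄ˣ`-valued datum, explicitly: `χ_σ(P) = σ(s_P) − s_{σP}` (additive
notation in `Additive K̄ˣ`; `s_P` = the chosen square root attached to the frame letter of `P`).
[cite: PoonenRains2012, §4.1 (Galois action on the Heisenberg group)] -/
theorem heisenbergGm_χ_eq (σ : absoluteGaloisGroup K) (P : geomTorsion W 2) :
    (heisenbergGm W h2).χ σ P
      = ThetaData.unitsAction (absoluteGaloisGroup K) (AlgebraicClosure K) σ
          (Additive.ofMul ((thetaData W h2).sUnit (frame W h2 P)))
        - Additive.ofMul ((thetaData W h2).sUnit (frame W h2 (σ • P))) := by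
  rw [heisenbergGm_χ, ThetaData.thetaDatum, HeisenbergDatum.gauge_χ, ThetaData.gmDatum_χ, ThetaData.gmDatum_α,
    ThetaData.gmDatum_ρ, zero_add, frame_smul]
  rfl

/-- `χ_σ(P)` depends only on `σ(s_P)` and `σP`. [cite: PoonenRains2012, §4.1 (Galois action on the Heisenberg group)] -/
theorem heisenbergGm_χ_congr {σ₁ σ₂ : absoluteGaloisGroup K} (P : geomTorsion W 2)
    (hs : σ₁ • (((thetaData W h2).sUnit (frame W h2 P) : (AlgebraicClosure K)ˣ) : AlgebraicClosure K)
      = σ₂ • (((thetaData W h2).sUnit (frame W h2 P) : (AlgebraicClosure K)ˣ) : AlgebraicClosure K))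
    (hP : σ₁ • P = σ₂ • P) :
    (heisenbergGm W h2).χ σ₁ P = (heisenbergGm W h2).χ σ₂ P := by
  rw [heisenbergGm_χ_eq, heisenbergGm_χ_eq, hP]
  congr 1
  apply Additive.toMul.injective
  apply Units.ext
  simpa only [ThetaData.coe_toMul_unitsAction, toMul_ofMul] using hs

/-- `χ^{μ}_σ(P)` (the `μ₂`-valued correction term) depends only on `σ(s_P)` and `σP`.
[cite: PoonenRains2012, §4.1 (Galois action on the Heisenberg group)] -/
theorem heisenbergMu_χ_congr {σ₁ σ₂ : absoluteGaloisGroup K} (P : geomTorsion W 2)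
    (hs : σ₁ • (((thetaData W h2).sUnit (frame W h2 P) : (AlgebraicClosure K)ˣ) : AlgebraicClosure K)
      = σ₂ • (((thetaData W h2).sUnit (frame W h2 P) : (AlgebraicClosure K)ˣ) : AlgebraicClosure K))
    (hP : σ₁ • P = σ₂ • P) :
    (heisenbergMu W h2).χ σ₁ P = (heisenbergMu W h2).χ σ₂ P := by
  rw [heisenbergMu, HeisenbergDatum.mapValues_χ, HeisenbergDatum.mapValues_χ]
  congr 1
  apply Subtype.ext
  rw [HeisenbergDatum.coe_codRestrict_χ, HeisenbergDatum.coe_codRestrict_χ]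
  exact heisenbergGm_χ_congr W h2 P hs hP

omit [W.IsElliptic] in
/-- `σ ↦ σP` is continuous (`E[2]` discrete). [cite: SerreGaloisCohomology1997, II.§1.1 (discrete Galois modules)] -/
theorem continuous_smul_torsion (P : geomTorsion W 2) : Continuous fun σ : absoluteGaloisGroup K => σ • P :=
  (W.torsionGaloisModule 2).continuous_apply_left P

/-- `σ ↦ σ(x)` is continuous into `K̄` with the DISCRETE topology, for `x` a unit (via the discrete
Galois module `K̄ˣ`): the preimage of any set is open. [cite: SerreGaloisCohomology1997, II.§1.1 (discrete Galois modules)] -/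
theorem isOpen_setOf_smul_eq (u : (AlgebraicClosure K)ˣ) (c : AlgebraicClosure K) :
    IsOpen {σ : absoluteGaloisGroup K | σ • (u : AlgebraicClosure K) = c} := by
  have hc : Continuous fun σ : absoluteGaloisGroup K => units K σ (UnitsCarrier.ofUnits u) :=
    (units K).continuous_apply_left _
  by_cases hcu : ∃ w : (AlgebraicClosure K)ˣ, (w : AlgebraicClosure K) = c
  · obtain ⟨w, rfl⟩ := hcu
    have : {σ : absoluteGaloisGroup K | σ • (u : AlgebraicClosure K) = w}
        = (fun σ => units K σ (UnitsCarrier.ofUnits u)) ⁻¹' {(UnitsCarrier.ofUnits w : UnitsCarrier K)} := by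
      ext σ
      simp only [Set.mem_setOf_eq, Set.mem_preimage, Set.mem_singleton_iff]
      constructor
      · intro h
        change Additive.ofMul (σ • u) = Additive.ofMul w
        exact congrArg Additive.ofMul (Units.ext (by rw [Units.coe_smul]; exact h))
      · intro h
        have h' : σ • u = w := Additive.ofMul.injective h
        rw [← h', Units.coe_smul]
    rw [this]
    exact (isOpen_discrete _).preimage hc
  · have : {σ : absoluteGaloisGroup K | σ • (u : AlgebraicClosure K) = c} = ∅ := by
      ext σ
      simp only [Set.mem_setOf_eq, Set.mem_empty_iff_false, iff_false]
      intro h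
      exact hcu ⟨σ • u, by rw [Units.coe_smul]; exact h⟩
    rw [this]
    exact isOpen_empty

/-- **Continuity of the correction terms**: for fixed `P ∈ E[2]`, `σ ↦ χ^{μ}_σ(P) ∈ μ₂` is continuous
(locally constant: it only depends on `σ(s_P)` and `σP`). [cite: PoonenRains2012, §4.1 (Galois action on the Heisenberg group)] -/
theorem continuous_heisenbergMu_χ (P : geomTorsion W 2) :
    Continuous fun σ : absoluteGaloisGroup K => (heisenbergMu W h2).χ σ P := by
  rw [continuous_discrete_rng]
  intro c
  rw [isOpen_iff_forall_mem_open]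
  intro σ₀ hσ₀
  refine ⟨{σ | σ • (((thetaData W h2).sUnit (frame W h2 P) : (AlgebraicClosure K)ˣ) : AlgebraicClosure K)
      = σ₀ • (((thetaData W h2).sUnit (frame W h2 P) : (AlgebraicClosure K)ˣ) : AlgebraicClosure K)}
      ∩ {σ | σ • P = σ₀ • P}, ?_, ?_, ?_⟩
  · intro σ hσ
    simp only [Set.mem_inter_iff, Set.mem_setOf_eq] at hσ
    simp only [Set.mem_preimage, Set.mem_singleton_iff] at hσ₀ ⊢
    rw [heisenbergMu_χ_congr W h2 P hσ.1 hσ.2]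
    exact hσ₀
  · exact (isOpen_setOf_smul_eq _ _).inter
      ((isOpen_discrete {σ₀ • P}).preimage (continuous_smul_torsion W P))
  · exact ⟨rfl, rfl⟩

/-! ### The cocycle over a `K`-field `L` -/

variable (L : Type u) [Field L] [Algebra K L]

/-- The level-`2` Heisenberg datum pulled back to `Γ_L` along `absGaloisRestrict K L` (the tree's
restriction used by `GaloisRep.restrictField`). [cite: PoonenRains2012, §4.1 (functoriality in the field)] -/
def localDatum : HeisenbergDatum (absoluteGaloisGroup L) (geomTorsion W 2) (MuCarrier K 2) :=
  (heisenbergMu W h2).comap (absGaloisRestrict K L : absoluteGaloisGroup L →ₜ* absoluteGaloisGroup K).toMonoidHom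

/-- The module action of `localDatum` is the restricted Galois action on `E[2]`. [cite: SerreGaloisCohomology1997, I §2.4 (compatible pairs)] -/
@[simp] theorem localDatum_ρ_apply (σ : absoluteGaloisGroup L) (P : geomTorsion W 2) :
    (localDatum W h2 L).ρ σ P = absGaloisRestrict K L σ • P := rfl

/-- The value action of `localDatum` is the restricted Galois module `μ₂`. [cite: SerreGaloisCohomology1997, I §2.4 (compatible pairs)] -/
@[simp] theorem localDatum_α_apply (σ : absoluteGaloisGroup L) (z : MuCarrier K 2) :
    (localDatum W h2 L).α σ z = mu K 2 (absGaloisRestrict K L σ) z := rfl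

omit [W.IsElliptic] in
/-- The action in the restricted topological module `E[2]|_{Γ_L}`: `ρ(σ) P = (res σ) • P`. [cite: SerreGaloisCohomology1997, I §2.4 (compatible pairs)] -/
theorem toTopRep_torsion_ρ_apply (σ : absoluteGaloisGroup L) (P : geomTorsion W 2) :
    (DiscreteGaloisModule.toTopRep (GaloisRep.restrictField L (W.torsionGaloisModule 2))).ρ σ P
      = absGaloisRestrict K L σ • P := rfl

/-- The underlying function `Γ_L → E[2]` of a continuous crossed homomorphism of `E[2]|_{Γ_L}`
(bookkeeping coercion). [cite: SerreGaloisCohomology1997, I §5.1 (cocycles, crossed homomorphisms)] -/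
def cocycleFun
    (ξ : contOneCocycles (DiscreteGaloisModule.toTopRep (GaloisRep.restrictField L (W.torsionGaloisModule 2)))) :
    absoluteGaloisGroup L → geomTorsion W 2 :=
  fun σ => ξ.1 σ

omit [W.IsElliptic] in
/-- Unfolding `cocycleFun`. [cite: SerreGaloisCohomology1997, I §5.1 (cocycles, crossed homomorphisms)] -/
@[simp] theorem cocycleFun_apply
    (ξ : contOneCocycles (DiscreteGaloisModule.toTopRep (GaloisRep.restrictField L (W.torsionGaloisModule 2))))
    (σ : absoluteGaloisGroup L) : cocycleFun W L ξ σ = ξ.1 σ := rfl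

omit [W.IsElliptic] in
/-- `cocycleFun ξ` is continuous (`E[2]` discrete). [cite: SerreGaloisCohomology1997, I §2.2 (continuous cochains)] -/
theorem continuous_cocycleFun
    (ξ : contOneCocycles (DiscreteGaloisModule.toTopRep (GaloisRep.restrictField L (W.torsionGaloisModule 2)))) :
    Continuous (cocycleFun W L ξ) := ξ.1.continuous

/-- A continuous crossed homomorphism of the restricted module `E[2]|_{Γ_L}` is a crossed homomorphism
for `localDatum`. [cite: SerreGaloisCohomology1997, I §5.1 (cocycles, crossed homomorphisms)] -/
theorem isCrossedHom_of_mem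
    (ξ : contOneCocycles (DiscreteGaloisModule.toTopRep (GaloisRep.restrictField L (W.torsionGaloisModule 2)))) :
    (localDatum W h2 L).IsCrossedHom (cocycleFun W L ξ) := fun σ τ => by
  rw [cocycleFun_apply, cocycleFun_apply, cocycleFun_apply, localDatum_ρ_apply, ← toTopRep_torsion_ρ_apply]
  exact ξ.2 σ τ

/-- The Poonen–Rains `2`-cochain of `ξ`: `(σ, τ) ↦ conn ξ (σ, τ) = χ_σ(ξ_τ) + m(ξ_σ, σξ_τ) ∈ μ₂`.
[cite: PoonenRains2012, Cor. 4.6 (connecting map of the Heisenberg group)] -/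
def prFun (ξ : contOneCocycles (DiscreteGaloisModule.toTopRep (GaloisRep.restrictField L (W.torsionGaloisModule 2)))) :
    absoluteGaloisGroup L × absoluteGaloisGroup L → MuCarrier K 2 :=
  fun p => (localDatum W h2 L).conn (cocycleFun W L ξ) p.1 p.2

/-- **Continuity of the Poonen–Rains cochain.**  `conn ξ (σ,τ) = χ_σ(ξ_τ) + m(ξ_σ, ξ_{στ} − ξ_σ)`; the
second term factors through the continuous map `(σ,τ) ↦ (ξ_σ, ξ_{στ})` into the discrete `E[2]²`, the
first through `(σ, τ) ↦ (σ, ξ_τ)` and the continuity of `σ ↦ χ_σ(P)` (`continuous_heisenbergMu_χ`).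
[cite: SerreGaloisCohomology1997, I §2.2 (continuous cochains)] -/
theorem continuous_prFun
    (ξ : contOneCocycles (DiscreteGaloisModule.toTopRep (GaloisRep.restrictField L (W.torsionGaloisModule 2)))) :
    Continuous (prFun W h2 L ξ) := by
  have hξ : Continuous (cocycleFun W L ξ) := continuous_cocycleFun W L ξ
  have hθ : Continuous (absGaloisRestrict K L : absoluteGaloisGroup L → absoluteGaloisGroup K) :=
    (absGaloisRestrict K L).continuous
  -- the two terms
  have h1 : Continuous fun p : absoluteGaloisGroup L × absoluteGaloisGroup L =>
      (heisenbergMu W h2).χ (absGaloisRestrict K L p.1) (cocycleFun W L ξ p.2) := by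
    rw [continuous_discrete_rng]
    intro c
    rw [isOpen_iff_forall_mem_open]
    rintro ⟨σ₀, τ₀⟩ h0
    refine ⟨{σ | (heisenbergMu W h2).χ (absGaloisRestrict K L σ) (cocycleFun W L ξ τ₀) = c}
      ×ˢ {τ | cocycleFun W L ξ τ = cocycleFun W L ξ τ₀}, ?_, ?_, ?_⟩
    · rintro ⟨σ, τ⟩ ⟨hσ, hτ⟩
      simp only [Set.mem_setOf_eq] at hσ hτ
      simp only [Set.mem_preimage, Set.mem_singleton_iff, hτ]
      exact hσ
    · exact ((isOpen_discrete {c}).preimage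
          ((continuous_heisenbergMu_χ W h2 (cocycleFun W L ξ τ₀)).comp hθ)).prod
        ((isOpen_discrete {cocycleFun W L ξ τ₀}).preimage hξ)
    · exact ⟨h0, rfl⟩
  have hpair : Continuous fun p : absoluteGaloisGroup L × absoluteGaloisGroup L =>
      ((heisenbergMu W h2).χ (absGaloisRestrict K L p.1) (cocycleFun W L ξ p.2),
        (cocycleFun W L ξ p.1, cocycleFun W L ξ (p.1 * p.2))) :=
    h1.prodMk ((hξ.comp continuous_fst).prodMk (hξ.comp continuous_mul))
  have heq : prFun W h2 L ξ = (fun t : MuCarrier K 2 × (geomTorsion W 2 × geomTorsion W 2) =>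
      t.1 + (heisenbergMu W h2).m t.2.1 (t.2.2 - t.2.1)) ∘ (fun p : absoluteGaloisGroup L × absoluteGaloisGroup L =>
      ((heisenbergMu W h2).χ (absGaloisRestrict K L p.1) (cocycleFun W L ξ p.2),
        (cocycleFun W L ξ p.1, cocycleFun W L ξ (p.1 * p.2)))) := by
    funext p
    have hc : (localDatum W h2 L).ρ p.1 (cocycleFun W L ξ p.2)
        = cocycleFun W L ξ (p.1 * p.2) - cocycleFun W L ξ p.1 := by
      rw [isCrossedHom_of_mem W h2 L ξ p.1 p.2, add_sub_cancel_left]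
    rw [Function.comp_apply, prFun, HeisenbergDatum.conn_apply, hc, localDatum, HeisenbergDatum.comap_χ,
      HeisenbergDatum.comap_m]
    rfl
  rw [heq]
  exact continuous_of_discreteTopology.comp hpair

/-- **The Poonen–Rains `2`-cocycle** of a continuous crossed homomorphism `ξ : Γ_L → E[2]`: the
continuous inhomogeneous `2`-cocycle `(σ,τ) ↦ χ_σ(ξ_τ)·m(ξ_σ, σξ_τ)` with values in `μ₂|_{Γ_L}`
(obstruction cocycle of `ξ` in the Heisenberg group; Serre I §5.7).
[cite: PoonenRains2012, Cor. 4.6 (connecting map of the Heisenberg group)] -/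
def prCocycle
    (ξ : contOneCocycles (DiscreteGaloisModule.toTopRep (GaloisRep.restrictField L (W.torsionGaloisModule 2)))) :
    contTwoCocycles (DiscreteGaloisModule.toTopRep (GaloisRep.restrictField L (mu K 2))) :=
  ⟨⟨prFun W h2 L ξ, continuous_prFun W h2 L ξ⟩, fun σ τ υ => by
    have key := (localDatum W h2 L).conn_cocycle (isCrossedHom_of_mem W h2 L ξ) σ τ υ
    rw [localDatum_α_apply, ← toTopRep_mu_ρ_apply] at key
    exact key⟩

/-- Values of the Poonen–Rains cocycle. [cite: PoonenRains2012, Cor. 4.6 (connecting map of the Heisenberg group)] -/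
@[simp] theorem prCocycle_apply
    (ξ : contOneCocycles (DiscreteGaloisModule.toTopRep (GaloisRep.restrictField L (W.torsionGaloisModule 2))))
    (σ τ : absoluteGaloisGroup L) :
    (prCocycle W h2 L ξ).1 (σ, τ) = (localDatum W h2 L).conn (cocycleFun W L ξ) σ τ := rfl

/-- The Poonen–Rains cocycle of `0` is `0`. [cite: PoonenRains2012, Cor. 4.6 (q is a quadratic form, q(0) = 0)] -/
theorem prCocycle_zero : prCocycle W h2 L 0 = 0 := by
  apply Subtype.ext
  apply ContinuousMap.ext
  rintro ⟨σ, τ⟩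
  have h0 : cocycleFun W L (0 : contOneCocycles
      (DiscreteGaloisModule.toTopRep (GaloisRep.restrictField L (W.torsionGaloisModule 2)))) = 0 := rfl
  rw [prCocycle_apply, h0]
  exact (localDatum W h2 L).conn_zero σ τ

/-- **Well-definedness on classes**: cohomologous crossed homomorphisms have cohomologous Poonen–Rains
cocycles (`HeisenbergDatum.conn_coboundary`: a principal change `σ ↦ σx − x` changes `conn` by an explicit
coboundary). [cite: SerreGaloisCohomology1997, I §5.7 (the connecting map is defined on H¹)] -/
theorem twoCocycleClass_prCocycle_eq_of_sub_principal
    (ξ ξ' : contOneCocycles (DiscreteGaloisModule.toTopRep (GaloisRep.restrictField L (W.torsionGaloisModule 2))))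
    (x : geomTorsion W 2) (hx : ∀ σ, cocycleFun W L ξ' σ = cocycleFun W L ξ σ + (absGaloisRestrict K L σ • x - x)) :
    haveI : CompactSpace (absoluteGaloisGroup L) := absoluteGaloisGroup_compactSpace L
    twoCocycleClass _ (prCocycle W h2 L ξ') = twoCocycleClass _ (prCocycle W h2 L ξ) := by
  haveI : CompactSpace (absoluteGaloisGroup L) := absoluteGaloisGroup_compactSpace L
  rw [← sub_eq_zero, ← twoCocycleClass_sub, twoCocycleClass_eq_zero_iff]
  -- the explicit `1`-cochain of `conn_coboundary`, negated
  let b : absoluteGaloisGroup L → MuCarrier K 2 := fun σ =>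
    -((localDatum W h2 L).χ σ x + (localDatum W h2 L).m (cocycleFun W L ξ σ) ((localDatum W h2 L).ρ σ x)
      - (localDatum W h2 L).m x (cocycleFun W L ξ σ + ((localDatum W h2 L).ρ σ x - x)))
  have hξc : Continuous (cocycleFun W L ξ) := continuous_cocycleFun W L ξ
  have hρ : Continuous fun σ : absoluteGaloisGroup L => (localDatum W h2 L).ρ σ x := by
    have : (fun σ : absoluteGaloisGroup L => (localDatum W h2 L).ρ σ x)
        = (fun σ' : absoluteGaloisGroup K => σ' • x) ∘ (absGaloisRestrict K L) := by
      funext σ; rfl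
    rw [this]
    exact (continuous_smul_torsion W x).comp (absGaloisRestrict K L).continuous
  have hχ : Continuous fun σ : absoluteGaloisGroup L => (localDatum W h2 L).χ σ x := by
    have : (fun σ : absoluteGaloisGroup L => (localDatum W h2 L).χ σ x)
        = (fun σ' : absoluteGaloisGroup K => (heisenbergMu W h2).χ σ' x) ∘ (absGaloisRestrict K L) := by
      funext σ; rfl
    rw [this]
    exact (continuous_heisenbergMu_χ W h2 x).comp (absGaloisRestrict K L).continuous
  have hbcont : Continuous b := by
    have htrip : Continuous fun σ : absoluteGaloisGroup L =>
        (cocycleFun W L ξ σ, ((localDatum W h2 L).ρ σ x, (localDatum W h2 L).χ σ x)) :=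
      hξc.prodMk (hρ.prodMk hχ)
    have hb : b = (fun t : geomTorsion W 2 × (geomTorsion W 2 × MuCarrier K 2) =>
        -(t.2.2 + (localDatum W h2 L).m t.1 t.2.1 - (localDatum W h2 L).m x (t.1 + (t.2.1 - x)))) ∘
        (fun σ : absoluteGaloisGroup L =>
          (cocycleFun W L ξ σ, ((localDatum W h2 L).ρ σ x, (localDatum W h2 L).χ σ x))) := by
      funext σ; rfl
    rw [hb]
    exact continuous_of_discreteTopology.comp htrip
  refine ⟨⟨b, hbcont⟩, fun σ τ => ?_⟩
  have key := (localDatum W h2 L).conn_coboundary (isCrossedHom_of_mem W h2 L ξ) x σ τ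
  have hξ' : cocycleFun W L ξ' = fun g => cocycleFun W L ξ g + ((localDatum W h2 L).ρ g x - x) := by
    funext g
    rw [hx g, localDatum_ρ_apply]
  rw [Submodule.coe_sub, ContinuousMap.sub_apply, prCocycle_apply, prCocycle_apply, toTopRep_mu_ρ_apply,
    ← localDatum_α_apply W h2 L, hξ', key]
  show _ = (localDatum W h2 L).α σ (b τ) - b (σ * τ) + b σ
  simp only [b, map_neg, map_add, map_sub]
  abel

include h2 in
/-- **The Poonen–Rains quadratic map on classes** `q_L : H¹(Γ_L, E[2]) → H²(Γ_L, μ₂)`: the class of the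
Poonen–Rains cocycle of any representing crossed homomorphism (independent of the choice by
`twoCocycleClass_prCocycle_eq_of_sub_principal`). [cite: PoonenRains2012, Cor. 4.6 (the quadratic form q : H¹(A[λ]) → H²(G_m))] -/
def prClass (c : galoisCohomology (GaloisRep.restrictField L (W.torsionGaloisModule 2)) 1) :
    galoisCohomology (GaloisRep.restrictField L (mu K 2)) 2 :=
  haveI : CompactSpace (absoluteGaloisGroup L) := absoluteGaloisGroup_compactSpace L
  twoCocycleClass _ (prCocycle W h2 L (Classical.choose (oneCocycleClass_surjective _ c)))

/-- `q_L [ξ] = [prCocycle ξ]` for EVERY representing crossed homomorphism `ξ`.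
[cite: PoonenRains2012, Cor. 4.6 (the quadratic form q : H¹(A[λ]) → H²(G_m))] -/
theorem prClass_oneCocycleClass
    (ξ : contOneCocycles (DiscreteGaloisModule.toTopRep (GaloisRep.restrictField L (W.torsionGaloisModule 2)))) :
    haveI : CompactSpace (absoluteGaloisGroup L) := absoluteGaloisGroup_compactSpace L
    prClass W h2 L (oneCocycleClass _ ξ) = twoCocycleClass _ (prCocycle W h2 L ξ) := by
  haveI : CompactSpace (absoluteGaloisGroup L) := absoluteGaloisGroup_compactSpace L
  unfold prClass
  set ξ₀ := Classical.choose (oneCocycleClass_surjective _ (oneCocycleClass _ ξ)) with hξ₀def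
  have hξ₀ : oneCocycleClass _ ξ₀ = oneCocycleClass _ ξ :=
    Classical.choose_spec (oneCocycleClass_surjective _ (oneCocycleClass _ ξ))
  have hdiff : oneCocycleClass _ (ξ₀ - ξ) = 0 := by rw [oneCocycleClass_sub, hξ₀, sub_self]
  obtain ⟨x, hx⟩ := (oneCocycleClass_eq_zero_iff _ _).mp hdiff
  apply twoCocycleClass_prCocycle_eq_of_sub_principal W h2 L ξ ξ₀ x
  intro σ
  have := hx σ
  rw [toTopRep_torsion_ρ_apply, Submodule.coe_sub, ContinuousMap.sub_apply] at this
  rw [cocycleFun_apply, cocycleFun_apply, ← this]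
  abel

/-- `q_L(0) = 0`. [cite: PoonenRains2012, Cor. 4.6 (q is a quadratic form)] -/
theorem prClass_zero : prClass W h2 L 0 = 0 := by
  haveI : CompactSpace (absoluteGaloisGroup L) := absoluteGaloisGroup_compactSpace L
  have h0 : (0 : galoisCohomology (GaloisRep.restrictField L (W.torsionGaloisModule 2)) 1)
      = oneCocycleClass _ 0 := (map_zero (oneCocycleClassₗ _)).symm
  rw [h0, prClass_oneCocycleClass, prCocycle_zero, twoCocycleClass_zero]
  rfl

end ThetaLevelTwo

end Literature.NumberTheory.EllipticCurves
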